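import Summits.QuantumFields.YangMills.Theorems.UnitScaleTiltProp7GaugePieceRows
import Literature.MathematicalPhysics.QuantumFieldTheory.Balaban1983to89.B9Eq39Adjoint
import HarnessLib

/-!
# Prop 7, route-R E′, (E1-c) brick F4d(iii) — THE `u = e^{c•ψ}` ROWS FROM THE `ψ` ROWS: `‖u − u′‖ ≤ e^{R₀}m_d`, `‖D_μu‖ ≤ e^{R₀}δ`, `‖D_μ(u − u′)‖ ≤ e^{R₀}(δ_d + 2δ′m_d)`

Route `UnitScaleTilt`, crux K1 child «MinimiserStabilityRegPr» (`stmt-QuantumFields-19200`), cell ym3-torus, width seat px15 (gen 2); pen «px15 g2: (E1-c) GO-LOCATE» (★p1 g15,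
2026-08-28T20:45:05Z), LOCATE `LOCATE-E1C-DIVLIPSCHITZ-px15g2.md` §6 (F4: inputs of F4d(ii) `norm_divB_conjPiece_sub_le` for the `P₁` piece).  THEOREMS ONLY (0 `def`, 0 `sorry`);
`--supports stmt-QuantumFields-19200`, count-neutral.  YM₃ on T³ is a ladder rung (R3), not the Clay problem; nothing here claims the stub, the crux, d = 4 or the mass gap.

WHAT (abstract lattice letters of `B9Eq39Adjoint` over a complete normed `ℂ`-algebra `E`; transports `U` with `‖R(U)M‖ = ‖M‖`; `|c| ≤ 1`; `‖ψ‖,‖ψ′‖ ≤ R₀`):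
* `R_smul'`, `R_exp` (`R(u)(e^X) = e^{R(u)X}`, Mathlib `exp_units_conj`), `covD_expField_eq` (`D_μ(e^{c•ψ})(y) = e^{R(U)(c•ψ(T y))} − e^{c•ψ(y)}` and `R(U)(c•ψ(Ty)) − c•ψ y = c•D_μψ(y)`);
* ★ `norm_expField_sub_le` (`‖e^{c•ψ y} − e^{c•ψ′ y}‖ ≤ e^{R₀}‖ψ y − ψ′ y‖`), ★ `norm_covD_expField_le` (`‖D_μ e^{c•ψ}(y)‖ ≤ e^{R₀}‖D_μψ(y)‖`),
  ★★ `norm_covD_expField_sub_le` (`‖D_μ(e^{c•ψ} − e^{c•ψ′})(y)‖ ≤ e^{R₀}(‖D_μ(ψ−ψ′)(y)‖ + ‖D_μψ′(y)‖(‖(ψ−ψ′)(T y)‖ + ‖(ψ−ψ′)(y)‖))`, F3a ✓p669408 four-point row of `exp`).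
HONEST SCOPE.  Elementary ([folklore]).

References: T. Bałaban, CMP 98 (1985) 17–51 [Balaban1985Averaging] ((19)–(21) p.21); CMP 99 (1985) 389–434 [Balaban1985BackgroundPropagators] ((3.8) p.392).
-/

set_option autoImplicit false

noncomputable section

open NormedSpace
open scoped Nat

namespace Summit.QuantumFields.YangMills.Theorems.Prop7ExpFieldRows

open Literature.MathematicalPhysics.QuantumFieldTheory.Balaban1983to89.B9Eq39Adjoint (R covD R_sub)
open Summit.QuantumFields.YangMills.Theorems.Prop7PowerSeriesSecondDiff (norm_exp_secondDiff_le)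
open Summit.QuantumFields.YangMills.Theorems.Prop7GaugePieceRows (norm_exp_sub_exp_le')

variable {E : Type*} [NormedRing E] [NormedAlgebra ℂ E] [CompleteSpace E]
variable {S : Type*} {ι : Type*} (T : ι → Equiv.Perm S) (U : ι → S → Eˣ)

omit [CompleteSpace E] in
/-- `R(u)(c•X) = c•R(u)X`. [folklore] -/
theorem R_smul' (u : Eˣ) (c : ℂ) (X : E) : R u (c • X) = c • R u X := by
  simp only [R, Algebra.mul_smul_comm, Algebra.smul_mul_assoc]

/-- `R(u)(e^X) = e^{R(u)X}` (conjugation is a continuous algebra automorphism; termwise on the exponential series). [folklore] -/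
theorem R_exp (u : Eˣ) (X : E) : R u (exp X) = exp (R u X) := by
  simp only [R]
  set Cj := ContinuousLinearMap.mulLeftRight ℂ E (u : E) (↑u⁻¹ : E) with hCj
  have hCapp : ∀ M : E, Cj M = (u : E) * M * (↑u⁻¹ : E) := fun M => ContinuousLinearMap.mulLeftRight_apply ℂ E _ _ _
  have h1 : HasSum (fun n : ℕ => Cj ((n !⁻¹ : ℂ) • X ^ n)) (Cj (exp X)) := (exp_series_hasSum_exp' (𝕂 := ℂ) X).mapL Cj
  have h2 := exp_series_hasSum_exp' (𝕂 := ℂ) ((u : E) * X * (↑u⁻¹ : E))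
  have heq : (fun n : ℕ => Cj ((n !⁻¹ : ℂ) • X ^ n)) = fun n : ℕ => (n !⁻¹ : ℂ) • ((u : E) * X * (↑u⁻¹ : E)) ^ n := by
    funext n
    rw [map_smul, hCapp, Units.conj_pow]
  rw [heq] at h1
  rw [← hCapp, h1.unique h2]

omit [CompleteSpace E] in
/-- `R(U μ y)(c•ψ(T μ y)) − c•ψ(y) = c•D_μψ(y)`. [folklore] -/
theorem R_smul_sub_eq (c : ℂ) (μ : ι) (ψ : S → E) (y : S) :
    R (U μ y) (c • ψ (T μ y)) - c • ψ y = c • covD T U μ ψ y := by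
  simp only [covD, R_smul', smul_sub]

/-- `D_μ(e^{c•ψ})(y) = e^{R(U)(c•ψ(T y))} − e^{c•ψ(y)}`. [folklore] -/
theorem covD_expField_eq (c : ℂ) (μ : ι) (ψ : S → E) (y : S) :
    covD T U μ (fun z => exp (c • ψ z)) y = exp (R (U μ y) (c • ψ (T μ y))) - exp (c • ψ y) := by
  simp only [covD, R_exp]

omit [CompleteSpace E] in
/-- `‖c•X‖ ≤ ‖X‖` for `|c| ≤ 1`. (bookkeeping) [folklore] -/
theorem norm_smul_le_of_le_one {c : ℂ} (hc : ‖c‖ ≤ 1) (X : E) : ‖c • X‖ ≤ ‖X‖ := by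
  rw [norm_smul]; nlinarith [norm_nonneg c, norm_nonneg X]

/-- ★ `‖e^{c•ψ y} − e^{c•ψ′ y}‖ ≤ e^{R₀}·‖ψ y − ψ′ y‖`. [cite: Balaban1985Averaging, (19)-(21) p.21] -/
theorem norm_expField_sub_le {c : ℂ} (hc : ‖c‖ ≤ 1) {ψ ψ' : S → E} {R₀ : ℝ} (hψ : ∀ y, ‖ψ y‖ ≤ R₀) (hψ' : ∀ y, ‖ψ' y‖ ≤ R₀) (y : S) :
    ‖exp (c • ψ y) - exp (c • ψ' y)‖ ≤ Real.exp R₀ * ‖ψ y - ψ' y‖ := by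
  have h := norm_exp_sub_exp_le' ((norm_smul_le_of_le_one hc _).trans (hψ y)) ((norm_smul_le_of_le_one hc _).trans (hψ' y))
  refine h.trans (mul_le_mul_of_nonneg_left ?_ (Real.exp_pos _).le)
  rw [← smul_sub]; exact norm_smul_le_of_le_one hc _

/-- ★ `‖D_μ(e^{c•ψ})(y)‖ ≤ e^{R₀}·‖D_μψ(y)‖`. [cite: Balaban1985Averaging, (19)-(21) p.21] -/
theorem norm_covD_expField_le (hR : ∀ μ y (M : E), ‖R (U μ y) M‖ = ‖M‖) {c : ℂ} (hc : ‖c‖ ≤ 1) {ψ : S → E} {R₀ : ℝ}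
    (hψ : ∀ y, ‖ψ y‖ ≤ R₀) (μ : ι) (y : S) :
    ‖covD T U μ (fun z => exp (c • ψ z)) y‖ ≤ Real.exp R₀ * ‖covD T U μ ψ y‖ := by
  rw [covD_expField_eq]
  have ha : ‖R (U μ y) (c • ψ (T μ y))‖ ≤ R₀ := by rw [hR]; exact (norm_smul_le_of_le_one hc _).trans (hψ _)
  have hb : ‖c • ψ y‖ ≤ R₀ := (norm_smul_le_of_le_one hc _).trans (hψ y)
  refine (norm_exp_sub_exp_le' ha hb).trans (mul_le_mul_of_nonneg_left ?_ (Real.exp_pos _).le)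
  rw [R_smul_sub_eq]; exact norm_smul_le_of_le_one hc _

/-- ★★ `‖D_μ(e^{c•ψ} − e^{c•ψ′})(y)‖ ≤ e^{R₀}·(‖D_μ(ψ−ψ′)(y)‖ + ‖D_μψ′(y)‖·(‖(ψ−ψ′)(T μ y)‖ + ‖(ψ−ψ′)(y)‖))` (the four-point row of `exp`).
[cite: Balaban1985Averaging, (19)-(21) p.21] -/
theorem norm_covD_expField_sub_le (hR : ∀ μ y (M : E), ‖R (U μ y) M‖ = ‖M‖) {c : ℂ} (hc : ‖c‖ ≤ 1) {ψ ψ' : S → E} {R₀ : ℝ}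
    (hψ : ∀ y, ‖ψ y‖ ≤ R₀) (hψ' : ∀ y, ‖ψ' y‖ ≤ R₀) (μ : ι) (y : S) :
    ‖covD T U μ (fun z => exp (c • ψ z) - exp (c • ψ' z)) y‖
      ≤ Real.exp R₀ * (‖covD T U μ (fun z => ψ z - ψ' z) y‖
          + ‖covD T U μ ψ' y‖ * (‖ψ (T μ y) - ψ' (T μ y)‖ + ‖ψ y - ψ' y‖)) := by
  have e : covD T U μ (fun z => exp (c • ψ z) - exp (c • ψ' z)) y
      = (exp (R (U μ y) (c • ψ (T μ y))) - exp (c • ψ y)) - (exp (R (U μ y) (c • ψ' (T μ y))) - exp (c • ψ' y)) := by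
    simp only [covD, R_sub, R_exp]; abel
  rw [e]
  have ha : ‖R (U μ y) (c • ψ (T μ y))‖ ≤ R₀ := by rw [hR]; exact (norm_smul_le_of_le_one hc _).trans (hψ _)
  have hb : ‖c • ψ y‖ ≤ R₀ := (norm_smul_le_of_le_one hc _).trans (hψ y)
  have ha' : ‖R (U μ y) (c • ψ' (T μ y))‖ ≤ R₀ := by rw [hR]; exact (norm_smul_le_of_le_one hc _).trans (hψ' _)
  have hb' : ‖c • ψ' y‖ ≤ R₀ := (norm_smul_le_of_le_one hc _).trans (hψ' y)
  have h := norm_exp_secondDiff_le ha hb ha' hb'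
  refine h.trans (mul_le_mul_of_nonneg_left ?_ (Real.exp_pos _).le)
  -- identify the four inner norms
  have e1 : R (U μ y) (c • ψ (T μ y)) - c • ψ y - (R (U μ y) (c • ψ' (T μ y)) - c • ψ' y) = c • covD T U μ (fun z => ψ z - ψ' z) y := by
    simp only [covD, R_sub, R_smul', smul_sub]; abel
  have e2 : R (U μ y) (c • ψ' (T μ y)) - c • ψ' y = c • covD T U μ ψ' y := R_smul_sub_eq T U c μ ψ' y
  have e3 : R (U μ y) (c • ψ (T μ y)) - R (U μ y) (c • ψ' (T μ y)) = R (U μ y) (c • (ψ (T μ y) - ψ' (T μ y))) := by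
    rw [← R_sub, smul_sub]
  have e4 : c • ψ y - c • ψ' y = c • (ψ y - ψ' y) := (smul_sub _ _ _).symm
  rw [e1, e2, e3, e4, hR]
  have i1 := norm_smul_le_of_le_one hc (covD T U μ (fun z => ψ z - ψ' z) y)
  have i2 := norm_smul_le_of_le_one hc (covD T U μ ψ' y)
  have i3 := norm_smul_le_of_le_one hc (ψ (T μ y) - ψ' (T μ y))
  have i4 := norm_smul_le_of_le_one hc (ψ y - ψ' y)
  have h0 : 0 ≤ ‖c • covD T U μ ψ' y‖ := norm_nonneg _
  have hsum : ‖c • (ψ (T μ y) - ψ' (T μ y))‖ + ‖c • (ψ y - ψ' y)‖ ≤ ‖ψ (T μ y) - ψ' (T μ y)‖ + ‖ψ y - ψ' y‖ := add_le_add i3 i4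
  have hprod := mul_le_mul i2 hsum (by positivity) (norm_nonneg _)
  linarith

end Summit.QuantumFields.YangMills.Theorems.Prop7ExpFieldRows

end
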